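import Mathlib
import Literature.MathematicalPhysics.QuantumFieldTheory.Balaban1983to89.B4
import Literature.MathematicalPhysics.QuantumFieldTheory.Balaban1983to89.B6

/-!
# `Balaban1983to89.B6FromB4` — the five USE SITES of the Sect. 5 Theorem of [3] = B4 in B6, as kernel-checked
instances of `B4.Sect5ThmUniform` modulo NAMED encoding hypotheses (cell census G-B6-05a (a)/(b)/(c), G-B6-12)

B6 = T. Bałaban, *Propagators and renormalization transformations for lattice gauge theories. II*, Commun. Math.
Phys. **96**, 223–250 (1984) [Balaban1984PropagatorsII] (held `paper:balaban1984-cmp96-propagators-rt-ii`; journal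
page = PDF page + 222; every quotation below is read from the page renders pp. 235–237, 242, 244, 246, 248–250
[PDF 13–15, 20, 22, 24, 26–28], `b2b-balaban-ref1/pages/1984-cmp96-propagators-rt-II/…-p0NN-x2.png`).  Its
reference *"[3] Bałaban, T.: Regularity and decay of lattice Green's functions. Commun. Math. Phys. 89, 571–597
(1983)"* (reference list p. 250) = B4 [Balaban1983RegularityDecay], whose Sect. 5 Theorem (p. 594, (5.6) ⇒
(5.7)–(5.8), (5.9) ⇒ (5.10)) the sibling module `…Balaban1983to89.B4` (unit b04, surge node T01.4) types verbatim in
two readings, `B4.Sect5ThmLiteral` (c₁, δ₁ chosen after (Ω, A)) and `B4.Sect5ThmUniform` (c₁, δ₁ functions of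
γ₀, c₀, δ₀ — the reading the proof p. 597 establishes: *"The constants δ₁, c₁ are functions of δ₀, γ₀, c₀"*).
Neither `…B4` nor `…B6` is modified; this module is the typed CITATION EDGE B6 ← B4 at the level of statements.

CITATION HEADER (lean-in-tree rule 2026-08-18).  B6 invokes the Sect. 5 Theorem of [3] — by name or by the words
"this implies" — at FIVE sites, always in the same logical shape: a family (indexed by the geometry (2.1)–(2.2), the
scale j and a cube □ or a region Λ) of symmetric "unit lattice operators" with (i) a lower bound γ‖·‖² DISPLAYED in B6
and said to depend on d and L only, (ii) an upper bound and an exponential decay of the KERNEL OF THE OPERATOR (said,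
not displayed), whence (iii) the kernel of the INVERSE (a covariance) *"has an exponential decay with a decay rate δ₁
depending on δ₀ and the bound γ₀"* (p. 237), *"independent of j and Λ"* (p. 242).  The sites (verbatim):
(S1) p. 235 [13]: *"Now we will consider the operator (Q′G′²Q′*)⁻¹. Of course the operator Q′G′²Q′* is positive
  definite, so its inverse is well defined. We will construct it and investigate its properties using again a random
  walk expansion. Our considerations are analogous to Sect. 5 of [3], concerning unit lattice operators. If we have one
  scale, i.e. Λ_k = T₁^{(k)}, then the operator is a unit lattice operator."*; (2.70) *"C_□ = ((Q′G′(□̃)²Q′*)↾_□)⁻¹,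
  C = Σ_{□∈𝒟} h_□C_□h_□"*; (2.71) *"⟨ω, (Q′G′(□̃)²Q′*)↾_□ω⟩ = … = (L^jη)^{d+4}⟨Q″*ω, Q′_jG′^ξ(□̃)²Q′_j*Q″*ω⟩, ξ = L^{−j}"*;
  p. 236 (2.78) *"⟨ω, Q′G′^ξ(□̃)²Q′*ω⟩ ≥ γ₀²‖ω₁‖² = γ₀²‖Q″*ω‖² ≥ γ₀²‖ω‖²"*; p. 237 [15]: *"Of course we have also a bound
  from above and an exponential decay of the kernel of Q′G′^ξ(□̃)²Q′* with the decay rate δ₀. Hence the operator C^ξ_□ is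
  bounded from above and below by absolute constants. We can use the theory developed in Sect. 5 [3] to conclude that
  it has an exponential decay with a decay rate δ₁ depending on δ₀ and the bound γ₀. Another way to prove it is to
  consider the operator e^{⟨a,·⟩}Q′G′^ξ(□̃)²Q′*e^{−⟨a,·⟩}, and to prove that it is almost equal to the operator without the
  exponential functions, the difference being of the order O(|a|), for a small vector a ∈ R^d. This gives a bound for this
  operator almost the same as (2.78), which implies an exponential decay. Thus we have |C^ξ_□(y, y′)| ≤ O(1)e^{−δ₁|y−y′|}
  (2.79) for y, y′ belonging to 𝔅∩□ rescaled to unit scale. From (2.71) we obtain the following scaling law for the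
  operators C_□: C_□(y, y′) = (L^jη)^{−d−4}C^ξ_□((L^jη)^{−1}y, (L^jη)^{−1}y′), (2.80) hence |C_□(y, y′)| ≤
  O(1)(L^jη)^{−d−4}e^{−δ₁(L^jη)^{−1}|y−y′|}, y, y′ ∈ 𝔅∩□. (2.81)"* — (2.81) is the input "δ₁ from (2.79)" of Prop. 2.3
  (2.87) (`B6.Prop23Printed`; cell GAPS G-B6-05).
(S2) p. 242 [20]: *"From this [(2.108)] we get an exponential decay of Δ′_j(y − y′) and the bound … (2.109) … Hence
  γ₀‖ω‖² ≤ ⟨ω, Δ′_jω⟩ ≤ γ₁‖ω‖² for ω : Q′₁ω = 0, (2.110) with positive constants γ₀, γ₁ dependent on d and L only. From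
  the theorem on unit lattice operators in [3] it follows that a covariance C′^{(j)}_Λ of the last Gaussian integrals in
  (2.106) is a bounded operator with an exponential decay independent of j and Λ."* (GAPS G-B6-07).
(S3) p. 246 [24]: *"Another consequence is a bound from below for the form (2.120), or for the form (2.122). These forms
  are bounded from below by γ″₀‖B‖² with a positive constant γ″₀ dependent on d and L only. This implies that a covariance
  C̃^{(j)}_Λ of the Gaussian integral in (2.119) is bounded from above by a positive constant dependent on d and L only,
  and it has an exponential decay with a decay rate having the same property."* — the form (2.120) p. 244 is taken *"on
  the configurations B satisfying B(b) = 0 for b ⊂ Γ_{y,x}, x ∈ B(y), y ∈ Λ′. (2.121)"*, a COORDINATE constraint.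
(S4) p. 248 [26]: (2.143) *"C_□ = ((QG_□Q*)↾_□)⁻¹"*, (2.144) *"⟨B, (QG_□Q*)↾_□B⟩ = (L^jη)^{d+2}⟨B, (QG^ξ_□Q*)↾_□B⟩ = …"*,
  then *"⟨B, (QG_□Q*)↾_□B⟩ ≥ γ₀‖B‖² (2.147) with a positive constant γ₀ depending on d and L only. Of course we have also
  a similar bound from above and an exponential decay of a kernel of the operator in (2.147). This implies the same
  properties for C^ξ_□ with the corresponding bounds and a decay rate δ₄. For the operator C_□ we get |C_□(b, b′)| ≤
  O(1)(L^jη)^{−d−2}e^{−δ₄(L^jη)^{−1}|b₋−b′₋|}, b, b′ ∈ 𝔅∩□. (2.148)"* (p. 249 [27]) — the input δ₄ of Prop. 2.7 (2.149)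
  (`B6.Prop27Printed`; GAPS G-B6-12: the theorem is not named at this site).
(S5) pp. 249–250 [27–28]: *"Let us denote the covariance of the Gaussian integration in (2.152) by C^{(k)}, or by
  C^{(k)}_Λ … (2.154) An easy way to get a useful representation for C^{(k)}_Λ is to get rid of the unnecessary
  variables in the integral above. We remove the variables B_b for b ⊂ Γ_{y,x} using the δ-functions δ_{Ax}(B). Next we
  remove the variables B_{b₀}, where b₀ is a bond belonging to B(c) for some c ∈ Λ′, and contained in c, using the
  δ-functions δ((QB)(c)). If we denote the remaining variables by B′, then we can write B = CB′, where C is a linear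
  operator, and we have … (2.155) hence C^{(k)}_Λ = C(C*Δ_kC)⁻¹C*. (2.156) By the definition of C we have of course that
  CB′ = 0 outside Λ, QCB′ = 0, (CB′)(Γ_{y,x}) = 0, x ∈ B(y), y ∈ Λ′, for arbitrary B′. The inequality (2.153) implies
  ⟨B′, C*Δ_kCB′⟩ ≥ (γ₀/12d²)L^{−d−1}‖CB′‖² ≥ γ′₀‖B′‖², (2.157) where γ′₀ = (γ₀/12d²)L^{−d−1}. C is a short-ranged
  operator, so C*Δ_kC has the same exponential decay as Δ_k. Now we may apply the theory developed in Sect. 5 of [3] on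
  unit lattice operators. It gives us an exponential decay, and all the other properties, for the operator (C*Δ_kC)⁻¹,
  hence for C^{(k)}_Λ also. Such a scheme will be applied in the future to investigate all unit lattice propagators
  defined by generalizations of the integrals (2.152), (2.154)."*

WHAT IS KERNEL-CHECKED HERE (elementary real / matrix arithmetic over the carriers of `…B4`; every analytic input is a
hypothesis OF THE PRINTED SHAPE, never an internally minted fact):
(1) `engine_of_sect5Uniform`: the form in which every site uses [3] — (5.7) at Λ = Ω, i.e. *decay of the full inverse
    A⁻¹ with (c₁, δ₁) chosen BEFORE the instance (Ω, A)* (`UnitLatticeEngine`) — follows from `B4.Sect5ThmUniform`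
    (`compress_refl`: A_Ω = A); `invDecay_of_sect5Literal` records what the LITERAL reading gives instead (constants
    after the instance: no uniformity in j, Λ, □).  This is residual (a) of G-B6-05a ("the dependence on d and L only,
    uniformly in j, is not displayed as a checked instance of (5.6)") DISCHARGED AT THE LEVEL OF THE IMPLICATION: given
    encodings of the site's operators as instances of (5.6) with ONE (γ, c₀, δ₀) — which is what B6 displays for γ
    ((2.78), (2.110), γ″₀ p. 246, (2.147), (2.157): "depending on d and L only") and SAYS for (c₀, δ₀) — ONE (O(1), δ₁)
    serves the whole family (`useSites_uniform`, `cubeSites_uniform`, `reductions_uniform`: the ∃ precedes the ∀ i).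
(2) `sandwich_decay`, `sandwich_lowerBound`, `sandwich_isSymm`, `hyp56_sandwich`, `decay_2156`: the reduction scheme
    PRINTED at (S5) — *"C is a short-ranged operator, so C*Δ_kC has the same exponential decay as Δ_k"* (with the
    explicit constant c₀e^{2δ₀r}m², r = range of C, m = its ℓ¹ row/column bound), (2.157) in vector form (the scalar
    form is `B6.bound2157`, unit b06), symmetry of C*Δ_kC, hence (5.6) for C*Δ_kC; and *"hence for C^{(k)}_Λ also"*:
    decay of (C*Δ_kC)⁻¹ ⇒ decay of C(C*Δ_kC)⁻¹C* = C^{(k)}_Λ (2.156), same lemma with the factors transposed.  The same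
    scheme is the evident (unwritten) reduction at (S2), where the constraint Q′₁ω = 0 is NOT a coordinate subspace
    (residual (b) of G-B6-05a; cell census C-B4-1): `reductions_uniform` delivers the asserted *"exponential decay
    independent of j and Λ"* for every family of constrained unit-lattice Gaussians B = CB′ whose data (Δ, C) satisfy
    the printed-shape hypotheses `Reduction.Printed` with constants fixed before the instance; at (S3) the constraint
    (2.121) is a coordinate one (C = an inclusion matrix, r = 0, m = 1).
(3) `scaled_kernel_bound`, `cubeSites_uniform`, `ineq279_281_of_sect5`, `ineq2148_of_sect5`: the scaling laws (2.80)
    ((L^jη)^{−d−4}) and its bond analogue behind (2.148) ((L^jη)^{−d−2}, from (2.144)) carry the unit-scale decay (2.79)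
    to (2.81), resp. to (2.148), by arithmetic; with (1) the pair ((2.79), (2.81)) — resp. (2.148) — holds with ONE O(1)
    and ONE δ₁ (resp. δ₄) for all (geometry, j, □) (`Ineq279_281`, `Ineq2148`).
WHAT REMAINS A NAMED HYPOTHESIS (= the located residuals; nothing of it is asserted):
* `B4.Sect5ThmUniform d N` itself (a published theorem with a printed proof, census C-B4-3; consumed as a hypothesis);
* per site, the instance of (5.6) for the ENCODED operator (`B4.Hyp56 U.Ω U.A γ c₀ δ₀`): its lower-bound conjunct is
  the displayed (2.78)/(2.110)/γ″₀/(2.147)/(2.157) transported through the encoding; its kernel-decay conjunct is what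
  B6 says and does not display — at (S1) "a bound from above and an exponential decay of the kernel of Q′G′^ξ(□̃)²Q′*
  with the decay rate δ₀" (of the type (2.68), in the scaled euclidean distance: cell GAPS G-pv08-2), at (S2) "an
  exponential decay of Δ′_j(y − y′)" read off the symbol (2.108) and at (S3) the decay of the operator of the form
  (2.120) via H′_j (2.132) — both resting on the j-uniform analyticity strip of the "analyticity method described in
  [3]" = residual (c) of G-B6-05a = G-B4-02 (see `…B4Strip`, unit b04-g2, for the supplied strip lemma) —, at (S4)
  "a similar bound from above and an exponential decay of a kernel of the operator in (2.147)", at (S5) the decay of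
  Δ_k (B5) — the last one then TRANSPORTED to C*Δ_kC by (2);
* the ENCODING itself (`UseSite.Encodes K σ` / `Reduction.Printed`): an injection ι of the site's index set (𝔅∩□
  rescaled to the unit scale — unit- and L-lattice points, p. 236; Λ-sites; Λ-bonds) into Ω × Fin N for a finite
  Ω ⊂ ℤ^d, under which the B6 kernel (taken with respect to the weighted product (2.69) at (S1)) is dominated by K ×
  the entries of A⁻¹ and the B6 distance |y − y′| is dominated from above via σ|y − y′| ≤ |ι y − ι y′|_∞ (B4's |x − x′|
  is typed as the sup-distance of ℤ^d; σ = d^{−1/2} for the euclidean one); at (S2) additionally a short-ranged,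
  ℓ¹-bounded, norm-non-decreasing parametrization C of ker Q′₁ (one site per block eliminated, as (S5) does for QB = 0:
  *"we remove the variables B_{b₀} … using the δ-functions δ((QB)(c))"*) — residual (b), now reduced to exhibiting C;
* the step from (2.81) to Prop. 2.3 (2.87) ((2.82)–(2.86), the random walk over cubes) and from (2.148) to Prop. 2.7 —
  not in this module (surge nodes T03.3/T03.7; `…B6Cor28`, `…B6RandomWalk`).
TYPING REMARKS (cell DIVERGENCE D-pv09g2.1–2).  (i) [3] states the theorem for *"functions φ : Ω → R^N"*, Ω ⊂ Z^d; B6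
applies it to functions on multi-scale point sets and on BONDS, with constraints removing single bond variables
((2.121), (2.154)).  The module is agnostic: the index set is abstract and ι is data.  Two concrete encodings fit: bonds
as R^{dn}-valued site functions (then removing single bonds is not a Λ-compression of (5.7) and the reduced operator
must be padded, A ⊕ γI, on the removed components — elementary, unwritten), or bonds as points b₋ + b₊ = 2x + e_μ ∈ Z^d
with N = n (then every constraint of (2.121)/(2.154) removes whole fibres, (5.7)/(2.156) apply as typed, distances
double).  (ii) `B4.Hyp56` bounds ENTRIES where the print bounds N × N blocks (D-b04.6): constants change by N-dependent
factors (here K·N²), N = the number of field components being fixed for the model; B6's "depending on d and L only"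
is read with N fixed.  (iii) [3] allows any Ω ⊂ Z^d and `B4.Idx` types Ω finite (D-b04.5); the index sets at
(S1)–(S5) are finite (𝔅∩□, p. 235: *"We have for ω defined on 𝔅∩□ (outside this set we put ω equal to 0)"*; the
sites, resp. bonds, of Λ), and at (S4) the operator G_□ lives on the torus T_□ but is inverted after restriction to □
(p. 248: *"We put B equal to 0 outside □, and we omit the superscripts ξ and □ in the sequel"*), so Ω ⊂ Z^d with the
lattice distance is the reading as long as the region does not wrap around a torus; at (S5) with Λ = the whole
lattice T^{(k)} (a torus, (2.152)) the theorem of [3] — printed for Ω ⊂ Z^d — is used on a torus: harmless for its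
random-walk proof, but not the printed statement, and outside `Reduction` as typed here (named, row G-pv09g2-1).

Value = typed skeleton + kernel-checked citation edge + located residuals (the named hypotheses ARE the gaps), NOT
summit progress.  Cell pub-balaban, unit `b2b-balaban-pv09-g2` (surge node prover #09, gen 2); census rows GAPS
C-pv09g2-1, G-pv09g2-1, DIVERGENCE D-pv09g2.1–2; consolidates G-B6-05/05a/07/12 of units r1/b06.
-/

namespace Literature.MathematicalPhysics.QuantumFieldTheory.Balaban1983to89.B6FromB4

open Literature.MathematicalPhysics.QuantumFieldTheory.Balaban1983to89
open Finset
open scoped Matrix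

/-! ## §1  The engine: (5.7) of [3] at Λ = Ω, constants before the instance -/

section Engine

variable {d N : ℕ}

/-- The index inclusion of Λ ⊆ Ω at Λ = Ω is the identity. [folklore] -/
theorem inclIdx_refl (Ω : Finset (Fin d → ℤ)) :
    B4.inclIdx (N := N) (Finset.Subset.refl Ω) = id := by
  funext p
  rfl

/-- "A_Λ = ΛAΛ" (B4 p. 594) at Λ = Ω is A itself: `B4.compress` along the identity inclusion. [folklore] -/
theorem compress_refl (Ω : Finset (Fin d → ℤ)) (A : Matrix (B4.Idx Ω N) (B4.Idx Ω N) ℝ) :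
    B4.compress (Finset.Subset.refl Ω) A = A := by
  unfold B4.compress
  rw [inclIdx_refl]
  exact Matrix.submatrix_id_id A

/-- The conclusion shape B6 takes from [3] at every site: entrywise exponential decay of the kernel of the INVERSE of a
unit-lattice operator A on L²(Ω), |A⁻¹(x, x′)| ≤ c₁e^{−δ₁|x−x′|} — (5.7) of [3] with Λ = Ω (*"|C_Λ(x,x′)| ≤
c₁e^{−δ₁|x−x′|}, x, x′ ∈ Λ, (5.7)"*, C_Λ = A_Λ⁻¹), |x − x′| the sup-distance of ℤ^d as in `B4.Hyp56`. [cite: Balaban1983RegularityDecay, (5.7) p.594] -/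
def InvDecay (Ω : Finset (Fin d → ℤ)) (A : Matrix (B4.Idx Ω N) (B4.Idx Ω N) ℝ) (c₁ δ₁ : ℝ) : Prop :=
  ∀ p q : B4.Idx Ω N, |A⁻¹ p q| ≤ c₁ * Real.exp (-(δ₁ * dist (p.1 : Fin d → ℤ) (q.1 : Fin d → ℤ)))

/-- (5.7)–(5.8) for the pair Ω ⊆ Ω give the decay of the full inverse A⁻¹ (first conjunct, A_Ω = A). [folklore] -/
theorem invDecay_of_concl57 {Ω : Finset (Fin d → ℤ)} {A : Matrix (B4.Idx Ω N) (B4.Idx Ω N) ℝ} {c₁ δ₁ : ℝ}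
    (h : B4.Concl57_58 Ω Ω (Finset.Subset.refl Ω) A c₁ δ₁) : InvDecay Ω A c₁ δ₁ := by
  intro p q
  have := h.1 p q
  rwa [compress_refl] at this

variable (d N)

/-- **The unit-lattice engine** — the Sect. 5 Theorem of [3] in the form B6 invokes it (pp. 235, 237, 242, 250: "the
theory developed in Sect. 5 [3] … unit lattice operators"): for all positive γ₀, c₀, δ₀ THERE ARE positive c₁, δ₁ such
that FOR EVERY finite Ω ⊂ ℤ^d and every symmetric A on L²(Ω; ℝ^N) with A ≥ γ₀I and |A(x,x′)| ≤ c₀e^{−δ₀|x−x′|} (5.6),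
the inverse satisfies |A⁻¹(x,x′)| ≤ c₁e^{−δ₁|x−x′|} — "a decay rate δ₁ depending on δ₀ and the bound γ₀" (p. 237),
"independent of j and Λ" (p. 242).  Derived below from `B4.Sect5ThmUniform` (Λ = Ω). [cite: Balaban1983RegularityDecay, Sect. 5 Theorem p.594 + p.597] -/
def UnitLatticeEngine : Prop :=
  ∀ γ₀ c₀ δ₀ : ℝ, 0 < γ₀ → 0 < c₀ → 0 < δ₀ → ∃ c₁ δ₁ : ℝ, 0 < c₁ ∧ 0 < δ₁ ∧
    ∀ (Ω : Finset (Fin d → ℤ)) (A : Matrix (B4.Idx Ω N) (B4.Idx Ω N) ℝ),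
      B4.Hyp56 Ω A γ₀ c₀ δ₀ → InvDecay Ω A c₁ δ₁

variable {d N}

/-- KERNEL-CHECKED: the uniform reading of the Sect. 5 Theorem of [3] (`B4.Sect5ThmUniform`, T01.4) yields the engine:
specialise (5.7) to Λ = Ω ⊆ Ω, where A_Ω = A (`compress_refl`).  The quantifier order ∃(c₁,δ₁) ∀(Ω,A) is inherited —
this is the whole content of "independent of j and Λ" once every instance of the family satisfies (5.6) with the same
(γ₀, c₀, δ₀). [folklore] -/
theorem engine_of_sect5Uniform (h : B4.Sect5ThmUniform d N) : UnitLatticeEngine d N := by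
  intro γ₀ c₀ δ₀ hγ hc hδ
  obtain ⟨c₁, δ₁, hc₁, hδ₁, H⟩ := h γ₀ c₀ δ₀ hγ hc hδ
  exact ⟨c₁, δ₁, hc₁, hδ₁, fun Ω A hA => invDecay_of_concl57 ((H Ω A hA).1 Ω (Finset.Subset.refl Ω))⟩

/-- For contrast (kernel-checked): the LITERAL reading `B4.Sect5ThmLiteral` gives, for each instance (Ω, A) separately,
SOME (c₁, δ₁) — constants after the instance, i.e. NOT the uniformity in (j, Λ, □) that (S1)–(S5) assert; the use
sites therefore consume the uniform reading (whose licence is B4 p. 597, census C-B4-3 / C-pv10-3). [folklore] -/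
theorem invDecay_of_sect5Literal (h : B4.Sect5ThmLiteral d N) (Ω : Finset (Fin d → ℤ))
    (A : Matrix (B4.Idx Ω N) (B4.Idx Ω N) ℝ) {γ₀ c₀ δ₀ : ℝ} (hγ : 0 < γ₀) (hc : 0 < c₀) (hδ : 0 < δ₀)
    (hA : B4.Hyp56 Ω A γ₀ c₀ δ₀) : ∃ c₁ δ₁ : ℝ, 0 < c₁ ∧ 0 < δ₁ ∧ InvDecay Ω A c₁ δ₁ := by
  obtain ⟨c₁, δ₁, hc₁, hδ₁, H, -⟩ := h Ω A γ₀ c₀ δ₀ hγ hc hδ hA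
  exact ⟨c₁, δ₁, hc₁, hδ₁, invDecay_of_concl57 (H Ω (Finset.Subset.refl Ω))⟩

end Engine

/-! ## §2  "C is a short-ranged operator, so C*Δ_kC has the same exponential decay as Δ_k" (p. 250) — the sandwich
lemmas, over arbitrary finite index sets carrying positions in a (pseudo)metric space -/

section Sandwich

variable {m n : Type} [Fintype m] {X : Type} [PseudoMetricSpace X]

/-- KERNEL-CHECKED, the sentence of p. 250 [PDF 28] *"C is a short-ranged operator, so C*Δ_kC has the same exponential
decay as Δ_k"* with its constant: if |D(u,v)| ≤ c₀e^{−δ₀dist(u,v)}, the left factor L has range ≤ r (L(i,u) ≠ 0 ⇒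
dist(i,u) ≤ r) and row ℓ¹-sums ≤ m_l, the right factor R has range ≤ r and column ℓ¹-sums ≤ m_r, then
|(LDR)(i,k)| ≤ c₀e^{2δ₀r}m_lm_r·e^{−δ₀dist(i,k)} (triangle inequality: dist(u,v) ≥ dist(i,k) − 2r on the support).
Used with (L, R) = (C*, C) for C*Δ_kC and with (L, R) = (C, C*) for C(C*Δ_kC)⁻¹C* = C^{(k)}_Λ (2.156). [cite: Balaban1984PropagatorsII, p.250] -/
theorem sandwich_decay {r c₀ δ₀ ml mr : ℝ} (pos : m → X) (pos' : n → X)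
    (L : Matrix n m ℝ) (D : Matrix m m ℝ) (R : Matrix m n ℝ)
    (hc : 0 ≤ c₀) (hδ : 0 ≤ δ₀)
    (hL : ∀ i u, L i u ≠ 0 → dist (pos' i) (pos u) ≤ r) (hL1 : ∀ i, ∑ u, |L i u| ≤ ml)
    (hR : ∀ v k, R v k ≠ 0 → dist (pos v) (pos' k) ≤ r) (hR1 : ∀ k, ∑ v, |R v k| ≤ mr)
    (hD : ∀ u v, |D u v| ≤ c₀ * Real.exp (-(δ₀ * dist (pos u) (pos v)))) :
    ∀ i k, |(L * D * R) i k| ≤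
      c₀ * Real.exp (2 * δ₀ * r) * ml * mr * Real.exp (-(δ₀ * dist (pos' i) (pos' k))) := by
  intro i k
  set X₀ := c₀ * Real.exp (2 * δ₀ * r) * Real.exp (-(δ₀ * dist (pos' i) (pos' k))) with hX₀
  have hX0 : 0 ≤ X₀ := by positivity
  have key : ∀ u v, |L i u| * |D u v| * |R v k| ≤ |L i u| * X₀ * |R v k| := by
    intro u v
    by_cases hLu : L i u = 0
    · simp [hLu]
    by_cases hRv : R v k = 0
    · simp [hRv]
    have h1 := hL i u hLu
    have h2 := hR v k hRv
    have htri : dist (pos' i) (pos' k) ≤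
        dist (pos' i) (pos u) + dist (pos u) (pos v) + dist (pos v) (pos' k) := by
      have := dist_triangle (pos' i) (pos u) (pos' k)
      have := dist_triangle (pos u) (pos v) (pos' k)
      linarith
    have hDuv : |D u v| ≤ X₀ := by
      refine (hD u v).trans ?_
      rw [hX₀, mul_assoc, ← Real.exp_add]
      apply mul_le_mul_of_nonneg_left _ hc
      apply Real.exp_le_exp.mpr
      have h3 : dist (pos' i) (pos' k) ≤ 2 * r + dist (pos u) (pos v) := by linarith
      have h4 := mul_le_mul_of_nonneg_left h3 hδ
      linarith
    apply mul_le_mul_of_nonneg_right _ (abs_nonneg _)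
    exact mul_le_mul_of_nonneg_left hDuv (abs_nonneg _)
  calc |(L * D * R) i k| = |∑ v, (∑ u, L i u * D u v) * R v k| := by simp only [Matrix.mul_apply]
    _ ≤ ∑ v, |(∑ u, L i u * D u v) * R v k| := Finset.abs_sum_le_sum_abs _ _
    _ ≤ ∑ v, (∑ u, |L i u| * |D u v|) * |R v k| := by
        apply Finset.sum_le_sum
        intro v _
        rw [abs_mul]
        apply mul_le_mul_of_nonneg_right _ (abs_nonneg _)
        refine (Finset.abs_sum_le_sum_abs _ _).trans ?_
        apply le_of_eq
        apply Finset.sum_congr rfl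
        intro u _
        exact abs_mul _ _
    _ = ∑ v, ∑ u, |L i u| * |D u v| * |R v k| := by
        apply Finset.sum_congr rfl
        intro v _
        rw [Finset.sum_mul]
    _ ≤ ∑ v, ∑ u, |L i u| * X₀ * |R v k| := by
        apply Finset.sum_le_sum
        intro v _
        apply Finset.sum_le_sum
        intro u _
        exact key u v
    _ ≤ ∑ v, ml * (X₀ * |R v k|) := by
        apply Finset.sum_le_sum
        intro v _
        have hsum : ∑ u, |L i u| * X₀ * |R v k| = (∑ u, |L i u|) * (X₀ * |R v k|) := by
          rw [Finset.sum_mul]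
          apply Finset.sum_congr rfl
          intro u _
          ring
        rw [hsum]
        exact mul_le_mul_of_nonneg_right (hL1 i) (mul_nonneg hX0 (abs_nonneg _))
    _ = ml * X₀ * ∑ v, |R v k| := by
        rw [Finset.mul_sum]
        apply Finset.sum_congr rfl
        intro v _
        ring
    _ ≤ ml * X₀ * mr := by
        apply mul_le_mul_of_nonneg_left (hR1 k)
        exact mul_nonneg ((Finset.sum_nonneg (fun u _ => abs_nonneg (L i u))).trans (hL1 i)) hX0
    _ = c₀ * Real.exp (2 * δ₀ * r) * ml * mr * Real.exp (-(δ₀ * dist (pos' i) (pos' k))) := by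
        rw [hX₀]; ring

/-- KERNEL-CHECKED, (2.157) p. 250 in vector form (the scalar shadow is `B6.bound2157`, unit b06): a lower bound
c‖CB′‖² ≤ ⟨CB′, DCB′⟩ on the RANGE of C (this is how *"The inequality (2.153) implies ⟨B′, C*Δ_kCB′⟩ ≥
(γ₀/12d²)L^{−d−1}‖CB′‖²"* is used: CB′ lies in the constrained subspace) and ‖CB′‖² ≥ ‖B′‖² (the second inequality of
(2.157)) give ⟨B′, C*DCB′⟩ ≥ c‖B′‖² — the lower-bound conjunct of (5.6) for C*DC. [cite: Balaban1984PropagatorsII, (2.157) p.250] -/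
theorem sandwich_lowerBound [Fintype n] (C : Matrix m n ℝ) (D : Matrix m m ℝ) {c : ℝ} (hc : 0 ≤ c)
    (hD : ∀ w : n → ℝ, c * ∑ u, (C *ᵥ w) u ^ 2 ≤ ∑ u, (C *ᵥ w) u * (D *ᵥ (C *ᵥ w)) u)
    (hC : ∀ w : n → ℝ, ∑ k, w k ^ 2 ≤ ∑ u, (C *ᵥ w) u ^ 2) :
    ∀ w : n → ℝ, c * ∑ k, w k ^ 2 ≤ ∑ k, w k * ((Cᵀ * D * C) *ᵥ w) k := by
  intro w
  have h1 : ∑ k, w k * ((Cᵀ * D * C) *ᵥ w) k = ∑ u, (C *ᵥ w) u * (D *ᵥ (C *ᵥ w)) u := by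
    change w ⬝ᵥ ((Cᵀ * D * C) *ᵥ w) = (C *ᵥ w) ⬝ᵥ (D *ᵥ (C *ᵥ w))
    rw [← Matrix.mulVec_mulVec, ← Matrix.mulVec_mulVec, Matrix.dotProduct_mulVec,
      Matrix.vecMul_transpose]
  rw [h1]
  exact (mul_le_mul_of_nonneg_left (hC w) hc).trans (hD w)

/-- KERNEL-CHECKED: C*DC is symmetric when D is (the symmetry conjunct of (5.6) for C*Δ_kC; Δ_k is the operator of a
quadratic form). [folklore] -/
theorem sandwich_isSymm (C : Matrix m n ℝ) {D : Matrix m m ℝ} (hD : D.IsSymm) :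
    (Cᵀ * D * C).IsSymm := by
  unfold Matrix.IsSymm at *
  rw [Matrix.transpose_mul, Matrix.transpose_mul, Matrix.transpose_transpose, hD, Matrix.mul_assoc]

end Sandwich

/-! ## §3  The reduction scheme of (S5) — and of (S2), (S3) — as an instance of (5.6) ⇒ (5.7) -/

section Reduced

variable {d N N' : ℕ}

/-- KERNEL-CHECKED, p. 250: for a unit-lattice operator Δ on the variables indexed by Ω × Fin N (entrywise decay
(c₀, δ₀), symmetric) and a parametrization B = CB′ of a constrained subspace by variables indexed by Ω′ × Fin N′
(range ≤ r, column ℓ¹-sums ≤ m, ‖CB′‖ ≥ ‖B′‖) on which ⟨CB′, ΔCB′⟩ ≥ γ‖CB′‖², the reduced operator C*ΔC satisfies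
condition (5.6) of [3] on Ω′ with (γ, c₀e^{2δ₀r}m², δ₀): *"⟨B′, C*Δ_kCB′⟩ ≥ … ≥ γ′₀‖B′‖², (2.157) … C is a short-ranged
operator, so C*Δ_kC has the same exponential decay as Δ_k. Now we may apply the theory developed in Sect. 5 of [3]"*. [cite: Balaban1984PropagatorsII, (2.157) p.250] -/
theorem hyp56_sandwich {Ω Ω' : Finset (Fin d → ℤ)}
    (C : Matrix (B4.Idx Ω N) (B4.Idx Ω' N') ℝ) (Δ : Matrix (B4.Idx Ω N) (B4.Idx Ω N) ℝ)
    {γ c₀ δ₀ r mC : ℝ} (hγ : 0 ≤ γ) (hc : 0 ≤ c₀) (hδ : 0 ≤ δ₀)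
    (hΔs : Δ.IsSymm)
    (hΔd : ∀ p q : B4.Idx Ω N,
      |Δ p q| ≤ c₀ * Real.exp (-(δ₀ * dist (p.1 : Fin d → ℤ) (q.1 : Fin d → ℤ))))
    (hlow : ∀ w : B4.Idx Ω' N' → ℝ,
      γ * ∑ u, (C *ᵥ w) u ^ 2 ≤ ∑ u, (C *ᵥ w) u * (Δ *ᵥ (C *ᵥ w)) u)
    (hiso : ∀ w : B4.Idx Ω' N' → ℝ, ∑ k, w k ^ 2 ≤ ∑ u, (C *ᵥ w) u ^ 2)
    (hrange : ∀ p k, C p k ≠ 0 → dist (p.1 : Fin d → ℤ) (k.1 : Fin d → ℤ) ≤ r)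
    (hcol : ∀ k, ∑ p, |C p k| ≤ mC) :
    B4.Hyp56 Ω' (Cᵀ * Δ * C) γ (c₀ * Real.exp (2 * δ₀ * r) * mC * mC) δ₀ := by
  refine ⟨sandwich_isSymm C hΔs, fun v => sandwich_lowerBound C Δ hγ hlow hiso v, ?_⟩
  intro p q
  exact sandwich_decay (fun u : B4.Idx Ω N => (u.1 : Fin d → ℤ))
    (fun k : B4.Idx Ω' N' => (k.1 : Fin d → ℤ)) Cᵀ Δ C hc hδ
    (fun i u h => by
      rw [dist_comm]
      exact hrange u i (by simpa using h))
    (fun i => by simpa using hcol i) hrange hcol hΔd p q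

/-- KERNEL-CHECKED, p. 250 *"It gives us an exponential decay … for the operator (C*Δ_kC)⁻¹, hence for C^{(k)}_Λ
also"*: decay of (C*ΔC)⁻¹ with (c₁, δ₁) and a short-ranged C (range ≤ r, row ℓ¹-sums ≤ m) give the decay of
C(C*ΔC)⁻¹C* — the covariance (2.156) *"C^{(k)}_Λ = C(C*Δ_kC)⁻¹C*"* — with (c₁e^{2δ₁r}m², δ₁). [cite: Balaban1984PropagatorsII, (2.156) p.250] -/
theorem decay_2156 {Ω Ω' : Finset (Fin d → ℤ)}
    (C : Matrix (B4.Idx Ω N) (B4.Idx Ω' N') ℝ) (Δ : Matrix (B4.Idx Ω N) (B4.Idx Ω N) ℝ)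
    {c₁ δ₁ r mC : ℝ} (hc₁ : 0 ≤ c₁) (hδ₁ : 0 ≤ δ₁)
    (hI : InvDecay Ω' (Cᵀ * Δ * C) c₁ δ₁)
    (hrange : ∀ p k, C p k ≠ 0 → dist (p.1 : Fin d → ℤ) (k.1 : Fin d → ℤ) ≤ r)
    (hrow : ∀ p, ∑ k, |C p k| ≤ mC) :
    ∀ p q : B4.Idx Ω N, |(C * (Cᵀ * Δ * C)⁻¹ * Cᵀ) p q| ≤
      c₁ * Real.exp (2 * δ₁ * r) * mC * mC *
        Real.exp (-(δ₁ * dist (p.1 : Fin d → ℤ) (q.1 : Fin d → ℤ))) := by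
  intro p q
  exact sandwich_decay (fun k : B4.Idx Ω' N' => (k.1 : Fin d → ℤ))
    (fun u : B4.Idx Ω N => (u.1 : Fin d → ℤ)) C (Cᵀ * Δ * C)⁻¹ Cᵀ hc₁ hδ₁
    hrange hrow
    (fun v k h => by
      rw [dist_comm]
      exact hrange k v (by simpa using h))
    (fun k => by simpa using hrow k) hI p q

variable (d N N')

/-- ONE INSTANCE of the constrained unit-lattice Gaussians of (S2), (S3), (S5) — index i = (geometry (2.1)–(2.2),
scale, region Λ): the operator Δ of the quadratic form on the variables indexed by Ω × Fin N (Δ′_j of (2.107) on the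
sites of Λ; the operator of the form (2.120) on the bonds of Λ; Δ_k on the bonds of Λ, (2.152)) and the parametrization
B = CB′ of the constrained subspace (ker Q′₁; (2.121); {QB = 0, B(Γ_{y,x}) = 0}) by free variables indexed by
Ω′ × Fin N′ (p. 250: *"If we denote the remaining variables by B′, then we can write B = CB′, where C is a linear
operator"*).  Ω, Ω′ finite subsets of the unit lattice ℤ^d (typing remark (i) of the header). [cite: Balaban1984PropagatorsII, (2.154)–(2.156) pp.249–250] -/
structure Reduction where
  /-- the lattice indices of the variables B (or ω) -/
  Ω : Finset (Fin d → ℤ)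
  /-- the lattice indices of the remaining variables B′ -/
  Ω' : Finset (Fin d → ℤ)
  /-- the operator of the quadratic form (Δ′_j, the operator of (2.120), Δ_k) -/
  Δ : Matrix (B4.Idx Ω N) (B4.Idx Ω N) ℝ
  /-- B = CB′ -/
  C : Matrix (B4.Idx Ω N) (B4.Idx Ω' N') ℝ

variable {d N N'}

/-- The covariance of the constrained Gaussian, (2.156) verbatim: *"C^{(k)}_Λ = C(C*Δ_kC)⁻¹C*"* (likewise C′^{(j)}_Λ of
(2.106) and C̃^{(j)}_Λ of (2.119), by the same computation (2.155)). [cite: Balaban1984PropagatorsII, (2.156) p.250] -/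
noncomputable def Reduction.cov (T : Reduction d N N') : Matrix (B4.Idx T.Ω N) (B4.Idx T.Ω N) ℝ :=
  T.C * (T.Cᵀ * T.Δ * T.C)⁻¹ * T.Cᵀ

/-- The PRINTED-SHAPE inputs of the reduction at one instance, with the constants (γ, c₀, δ₀, r, m) as parameters so
that a family can be required to satisfy them UNIFORMLY: Δ symmetric with |Δ(x,x′)| ≤ c₀e^{−δ₀|x−x′|} (at (S5): the
decay of Δ_k, B5; at (S2): *"an exponential decay of Δ′_j(y − y′)"* from (2.108) — residual (c) = G-B4-02; at (S3):
the decay of the operator of (2.120) via (2.132) — same residual); the lower bound γ‖CB′‖² ≤ ⟨CB′, ΔCB′⟩ on the range of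
C ((2.157)/(2.153) with γ = γ′₀ = (γ₀/12d²)L^{−d−1}; (2.110) with γ = γ₀(d, L); p. 246 with γ = γ″₀(d, L));
‖CB′‖² ≥ ‖B′‖² ((2.157), second inequality: B′ are some of the coordinates of CB′); C short-ranged (p. 250: *"C is a
short-ranged operator"*) with ℓ¹-bounded rows and columns.  [cite: Balaban1984PropagatorsII, (2.110) p.242 + p.246 + (2.153)–(2.157) pp.249–250] -/
structure Reduction.Printed (T : Reduction d N N') (γ c₀ δ₀ r mC : ℝ) : Prop where
  symm : T.Δ.IsSymm
  decay : ∀ p q : B4.Idx T.Ω N,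
    |T.Δ p q| ≤ c₀ * Real.exp (-(δ₀ * dist (p.1 : Fin d → ℤ) (q.1 : Fin d → ℤ)))
  lower : ∀ w : B4.Idx T.Ω' N' → ℝ,
    γ * ∑ u, (T.C *ᵥ w) u ^ 2 ≤ ∑ u, (T.C *ᵥ w) u * (T.Δ *ᵥ (T.C *ᵥ w)) u
  iso : ∀ w : B4.Idx T.Ω' N' → ℝ, ∑ k, w k ^ 2 ≤ ∑ u, (T.C *ᵥ w) u ^ 2
  range : ∀ p k, T.C p k ≠ 0 → dist (p.1 : Fin d → ℤ) (k.1 : Fin d → ℤ) ≤ r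
  col : ∀ k, ∑ p, |T.C p k| ≤ mC
  row : ∀ p, ∑ k, |T.C p k| ≤ mC

/-- KERNEL-CHECKED, the assertions of (S2) *"a covariance C′^{(j)}_Λ … is a bounded operator with an exponential decay
independent of j and Λ"*, (S3) *"… it has an exponential decay with a decay rate having the same property [d and L
only]"* and (S5) *"It gives us an exponential decay … for the operator (C*Δ_kC)⁻¹, hence for C^{(k)}_Λ also"*, AS AN
INSTANCE OF [3]: from the Sect. 5 Theorem of [3] (uniform reading, at the reduced fibre N′) there are ONE c and ONE δ
such that EVERY instance whose data satisfy the printed-shape inputs with the same (γ, c₀, δ₀, r, m) has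
|cov(x, x′)| ≤ c·e^{−δ|x−x′|}.  Chain: `hyp56_sandwich` ((5.6) for C*ΔC with (γ, c₀e^{2δ₀r}m², δ₀)) →
`engine_of_sect5Uniform` ((5.7), Λ = Ω′) → `decay_2156`; c = c₁e^{2δ₁r}m², δ = δ₁. [cite: Balaban1984PropagatorsII, p.242 + p.246 + p.250] -/
theorem reductions_uniform (h5 : B4.Sect5ThmUniform d N') {γ c₀ δ₀ r mC : ℝ} (hγ : 0 < γ) (hc : 0 < c₀)
    (hδ : 0 < δ₀) (hm : 0 < mC) :
    ∃ c δ : ℝ, 0 < c ∧ 0 < δ ∧ ∀ T : Reduction d N N', T.Printed γ c₀ δ₀ r mC →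
      ∀ p q : B4.Idx T.Ω N,
        |T.cov p q| ≤ c * Real.exp (-(δ * dist (p.1 : Fin d → ℤ) (q.1 : Fin d → ℤ))) := by
  have hc' : 0 < c₀ * Real.exp (2 * δ₀ * r) * mC * mC := by positivity
  obtain ⟨c₁, δ₁, hc₁, hδ₁, H⟩ := engine_of_sect5Uniform h5 γ _ δ₀ hγ hc' hδ
  refine ⟨c₁ * Real.exp (2 * δ₁ * r) * mC * mC, δ₁, by positivity, hδ₁, fun T hT p q => ?_⟩
  have h56 := hyp56_sandwich T.C T.Δ hγ.le hc.le hδ.le hT.symm hT.decay hT.lower hT.iso hT.range hT.col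
  exact decay_2156 T.C T.Δ hc₁.le hδ₁.le (H T.Ω' _ h56) hT.range hT.row p q

end Reduced

/-! ## §4  The unconstrained sites (S1), (S4): a B6 kernel encoded as (dominated by) the inverse of a unit-lattice
operator -/

section UseSites

variable {d N : ℕ}

variable (d N) in
/-- ONE USE SITE INSTANCE of the unconstrained kind ((S1): i = (geometry, j, □ ∈ 𝒟_j), (S4): the same on bonds): an
abstract finite point set `S` (𝔅∩□ *"rescaled to unit scale"*, p. 237 — unit-lattice points of Λ_j∩□ and L-lattice
points of Λ_{j+1}∩□, p. 236: *"ω₁ is on the unit lattice"*), the B6 kernel on it whose decay is asserted (`ker`: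
C^ξ_□(y, y′), taken with respect to the weighted product (2.69) *"⟨λ, λ′⟩ = Σ_{j=0}^k Σ_{y∈Λ_j}(L^jη)^dλ(y)λ′(y)"* on the
unit scale), the B6 distance in the asserted bound (`ρ`: |y − y′| of the rescaled points), and the ENCODING as a unit
lattice operator of [3]: a finite Ω ⊂ ℤ^d, a matrix A on Ω × Fin N (the symmetrised matrix of (Q′G′^ξ(□̃)²Q′*)↾_□ in the
weighted product, whose inverse matrix carries C^ξ_□), and the position ι(y) ∈ Ω of each point. [cite: Balaban1984PropagatorsII, (2.69)–(2.70) p.235 + (2.79) p.237] -/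
structure UseSite where
  /-- the index set of the site (points of 𝔅∩□ rescaled; bonds) -/
  S : Type
  /-- the B6 kernel whose decay is asserted (C^ξ_□) -/
  ker : S → S → ℝ
  /-- the B6 distance in the assertion (|y − y′| on the unit scale) -/
  ρ : S → S → ℝ
  /-- the unit-lattice index region of the encoding -/
  Ω : Finset (Fin d → ℤ)
  /-- the encoded operator (symmetrised matrix of the B6 operator) -/
  A : Matrix (B4.Idx Ω N) (B4.Idx Ω N) ℝ
  /-- positions -/
  ι : S → ↥Ω

/-- The ENCODING HYPOTHESES at one site, with constants (K, σ) as parameters (to be uniform over a family): the B6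
kernel is dominated by K × the entries of A⁻¹ at the encoded positions (for the weighted product (2.69) on the unit
scale the weights are L^{(j′−j)d} ∈ {1, L^d}, so K depends on d, L only), and the B6 distance is dominated through the
positions, σ·ρ(y, y′) ≤ |ι y − ι y′|_∞ (σ = d^{−1/2} if ρ is euclidean).  This is the *"routine encoding of a multi-scale
bond/site set with the weighted products (2.69) as Ω ⊂ Z^d, functions R^N-valued"* of census G-B6-05a/G-B6-12 (ii),
NAMED, not performed. [cite: Balaban1984PropagatorsII, (2.69) p.235 + p.237] -/
structure UseSite.Encodes (U : UseSite d N) (K σ : ℝ) : Prop where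
  dom : ∀ y y', |U.ker y y'| ≤ K * ∑ a : Fin N, ∑ b : Fin N, |U.A⁻¹ (U.ι y, a) (U.ι y', b)|
  distLe : ∀ y y', σ * U.ρ y y' ≤ dist ((U.ι y).1 : Fin d → ℤ) ((U.ι y').1 : Fin d → ℤ)

/-- KERNEL-CHECKED: at one site, decay (c₁, δ₁) of A⁻¹ and the encoding (K, σ) give |ker(y, y′)| ≤
K·N²·c₁·e^{−δ₁σρ(y,y′)} (N² entries per block; typing remark (ii)). [folklore] -/
theorem useSite_bound {U : UseSite d N} {K σ c₁ δ₁ : ℝ} (hK : 0 ≤ K) (hc : 0 ≤ c₁) (hδ : 0 ≤ δ₁)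
    (hE : U.Encodes K σ) (hI : InvDecay U.Ω U.A c₁ δ₁) :
    ∀ y y', |U.ker y y'| ≤ K * (N : ℝ) ^ 2 * c₁ * Real.exp (-(δ₁ * σ * U.ρ y y')) := by
  intro y y'
  have hterm : ∀ a b : Fin N,
      |U.A⁻¹ (U.ι y, a) (U.ι y', b)| ≤ c₁ * Real.exp (-(δ₁ * σ * U.ρ y y')) := by
    intro a b
    refine (hI (U.ι y, a) (U.ι y', b)).trans ?_
    apply mul_le_mul_of_nonneg_left _ hc
    apply Real.exp_le_exp.mpr
    have := mul_le_mul_of_nonneg_left (hE.distLe y y') hδ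
    dsimp only
    linarith
  have hsum : ∑ a : Fin N, ∑ b : Fin N, |U.A⁻¹ (U.ι y, a) (U.ι y', b)| ≤
      (N : ℝ) ^ 2 * (c₁ * Real.exp (-(δ₁ * σ * U.ρ y y'))) := by
    calc ∑ a : Fin N, ∑ b : Fin N, |U.A⁻¹ (U.ι y, a) (U.ι y', b)|
        ≤ ∑ a : Fin N, ∑ b : Fin N, c₁ * Real.exp (-(δ₁ * σ * U.ρ y y')) :=
          Finset.sum_le_sum fun a _ => Finset.sum_le_sum fun b _ => hterm a b
      _ = (N : ℝ) ^ 2 * (c₁ * Real.exp (-(δ₁ * σ * U.ρ y y'))) := by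
          simp only [Finset.sum_const, Finset.card_univ, Fintype.card_fin, nsmul_eq_mul]
          ring
  calc |U.ker y y'| ≤ K * ∑ a : Fin N, ∑ b : Fin N, |U.A⁻¹ (U.ι y, a) (U.ι y', b)| := hE.dom y y'
    _ ≤ K * ((N : ℝ) ^ 2 * (c₁ * Real.exp (-(δ₁ * σ * U.ρ y y')))) :=
        mul_le_mul_of_nonneg_left hsum hK
    _ = K * (N : ℝ) ^ 2 * c₁ * Real.exp (-(δ₁ * σ * U.ρ y y')) := by ring

/-- KERNEL-CHECKED, the use-site form of residual (a): from the Sect. 5 Theorem of [3] (uniform reading) there are ONE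
O(1) and ONE rate δ such that EVERY use site whose encoded operator satisfies (5.6) with the same (γ₀, c₀, δ₀) and
whose encoding has the same (K, σ) obeys |ker(y, y′)| ≤ O(1)e^{−δρ(y,y′)} — *"a decay rate δ₁ depending on δ₀ and the
bound γ₀"* (p. 237).  O(1) = K·N²·c₁ + 1, δ = δ₁σ. [cite: Balaban1984PropagatorsII, p.237] -/
theorem useSites_uniform (h5 : B4.Sect5ThmUniform d N) {γ₀ c₀ δ₀ K σ : ℝ} (hγ : 0 < γ₀)
    (hc : 0 < c₀) (hδ : 0 < δ₀) (hK : 0 ≤ K) (hσ : 0 < σ) :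
    ∃ C δ : ℝ, 0 < C ∧ 0 < δ ∧ ∀ U : UseSite d N, B4.Hyp56 U.Ω U.A γ₀ c₀ δ₀ → U.Encodes K σ →
      ∀ y y', |U.ker y y'| ≤ C * Real.exp (-(δ * U.ρ y y')) := by
  obtain ⟨c₁, δ₁, hc₁, hδ₁, H⟩ := engine_of_sect5Uniform h5 γ₀ c₀ δ₀ hγ hc hδ
  refine ⟨K * (N : ℝ) ^ 2 * c₁ + 1, δ₁ * σ, by positivity, mul_pos hδ₁ hσ, fun U hA hE y y' => ?_⟩
  have h1 := useSite_bound hK hc₁.le hδ₁.le hE (H U.Ω U.A hA) y y'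
  have he : 0 ≤ Real.exp (-(δ₁ * σ * U.ρ y y')) := (Real.exp_pos _).le
  have h2 : (K * (N : ℝ) ^ 2 * c₁ + 1) * Real.exp (-(δ₁ * σ * U.ρ y y')) =
      K * (N : ℝ) ^ 2 * c₁ * Real.exp (-(δ₁ * σ * U.ρ y y')) + Real.exp (-(δ₁ * σ * U.ρ y y')) := by
    ring
  linarith

/-! ### The scaling laws (2.80) and (2.144) ⇒ (2.81), (2.148) -/

/-- KERNEL-CHECKED arithmetic of the word *"hence"* between (2.80) and (2.81) p. 237 (and of *"For the operator C_□ we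
get (2.148)"* p. 249): if a kernel is t^{−e} times a kernel bounded by Ce^{−δ₁ρ} (t = L^jη > 0; e = d + 4 by (2.71)/
(2.80), e = d + 2 by (2.144)), it is bounded by C·t^{−e}·e^{−δ₁ρ}.  (ρ(y, y′) = |y − y′| for the rescaled points =
(L^jη)^{−1}|y − y′| for the original ones, the exponent printed in (2.81)/(2.148).) [cite: Balaban1984PropagatorsII, (2.80)–(2.81) p.237] -/
theorem scaled_kernel_bound {S : Type} (kerU kerC : S → S → ℝ) (ρ : S → S → ℝ) {t C δ₁ e : ℝ}
    (ht : 0 < t)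
    (hU : ∀ y y', |kerU y y'| ≤ C * Real.exp (-(δ₁ * ρ y y')))
    (hscale : ∀ y y', kerC y y' = t ^ (-e) * kerU y y') :
    ∀ y y', |kerC y y'| ≤ C * t ^ (-e) * Real.exp (-(δ₁ * ρ y y')) := by
  intro y y'
  rw [hscale, abs_mul, abs_of_pos (Real.rpow_pos_of_pos ht _)]
  calc t ^ (-e) * |kerU y y'| ≤ t ^ (-e) * (C * Real.exp (-(δ₁ * ρ y y'))) :=
        mul_le_mul_of_nonneg_left (hU y y') (Real.rpow_pos_of_pos ht _).le
    _ = C * t ^ (-e) * Real.exp (-(δ₁ * ρ y y')) := by ring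

variable (d N) in
/-- ONE CUBE INSTANCE i = (geometry, j, □) of (S1) (resp. (S4), on bonds): a use site (the unit-scale kernel C^ξ_□ and
its encoding) together with the scaling factor t = L^jη and the original-scale kernel C_□ of (2.70) (resp. (2.143)). [cite: Balaban1984PropagatorsII, (2.70) + (2.80) pp.235–237 + (2.143) p.248] -/
structure CubeSite extends UseSite d N where
  /-- L^jη -/
  t : ℝ
  /-- the kernel of C_□ on the same points (original scale) -/
  kerCube : S → S → ℝ

/-- The pair ((2.79), (2.81)) — resp. (2.148) with its unit-scale version — for a whole family with ONE O(1) and ONE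
rate, scaling exponent e: ∀ i, |C^ξ_□(y, y′)| ≤ O(1)e^{−δρ(y,y′)} ∧ |C_□(y, y′)| ≤ O(1)(L^jη)^{−e}e^{−δρ(y,y′)}, ρ(y, y′) =
(L^jη)^{−1}|y − y′|.  (2.79)/(2.81) verbatim: *"|C^ξ_□(y, y′)| ≤ O(1)e^{−δ₁|y−y′|} (2.79) for y, y′ belonging to 𝔅∩□
rescaled to unit scale … |C_□(y, y′)| ≤ O(1)(L^jη)^{−d−4}e^{−δ₁(L^jη)^{−1}|y−y′|}, y, y′ ∈ 𝔅∩□. (2.81)"*; (2.148)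
verbatim: *"|C_□(b, b′)| ≤ O(1)(L^jη)^{−d−2}e^{−δ₄(L^jη)^{−1}|b₋−b′₋|}, b, b′ ∈ 𝔅∩□. (2.148)"*. [cite: Balaban1984PropagatorsII, (2.79)–(2.81) p.237 + (2.148) p.249] -/
def ScaledFamilyBound {I : Type} (e : ℝ) (fam : I → CubeSite d N) (C δ : ℝ) : Prop :=
  ∀ i : I, (∀ y y', |(fam i).ker y y'| ≤ C * Real.exp (-(δ * (fam i).ρ y y'))) ∧
    (∀ y y', |(fam i).kerCube y y'| ≤ C * (fam i).t ^ (-e) * Real.exp (-(δ * (fam i).ρ y y')))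

/-- KERNEL-CHECKED, the generic cube-site theorem: Sect. 5 Theorem of [3] (uniform) + per-instance (5.6) with ONE
(γ, c₀, δ₀) + encodings with ONE (K, σ) + the scaling law with exponent e and t_i > 0 ⟹ the family bound with ONE
O(1), ONE rate. [folklore] -/
theorem cubeSites_uniform {I : Type} (h5 : B4.Sect5ThmUniform d N) (e : ℝ) (fam : I → CubeSite d N)
    {γ c₀ δ₀ K σ : ℝ} (hγ : 0 < γ) (hc : 0 < c₀) (hδ : 0 < δ₀) (hK : 0 ≤ K) (hσ : 0 < σ)
    (h56 : ∀ i, B4.Hyp56 (fam i).Ω (fam i).A γ c₀ δ₀)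
    (henc : ∀ i, (fam i).toUseSite.Encodes K σ)
    (ht : ∀ i, 0 < (fam i).t)
    (hscale : ∀ i y y', (fam i).kerCube y y' = (fam i).t ^ (-e) * (fam i).ker y y') :
    ∃ C δ : ℝ, 0 < C ∧ 0 < δ ∧ ScaledFamilyBound e fam C δ := by
  obtain ⟨C, δ, hC, hδ', H⟩ := useSites_uniform h5 hγ hc hδ hK hσ
  refine ⟨C, δ, hC, hδ', fun i => ⟨H (fam i).toUseSite (h56 i) (henc i), ?_⟩⟩
  exact scaled_kernel_bound (fam i).ker (fam i).kerCube (fam i).ρ (ht i)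
    (H (fam i).toUseSite (h56 i) (henc i)) (hscale i)

/-- (2.79) ∧ (2.81) for the family of all (geometry, j, □), ONE O(1), ONE δ₁ (exponent d + 4). [cite: Balaban1984PropagatorsII, (2.79)–(2.81) p.237] -/
def Ineq279_281 {I : Type} (fam : I → CubeSite d N) (C δ₁ : ℝ) : Prop :=
  ScaledFamilyBound ((d : ℝ) + 4) fam C δ₁

/-- KERNEL-CHECKED, site (S1) as an instance of [3]: `B4.Sect5ThmUniform` + for every (geometry, j, □) the instance of
(5.6) for the encoded (Q′G′^ξ(□̃)²Q′*)↾_□ with lower bound γ₀² ((2.78): *"⟨ω, Q′G′^ξ(□̃)²Q′*ω⟩ ≥ … ≥ γ₀²‖ω‖²"*) and kernel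
decay (c₀, δ₀) (p. 237: *"a bound from above and an exponential decay of the kernel of Q′G′^ξ(□̃)²Q′* with the decay rate
δ₀"*, NOT displayed) + encodings with one (K, σ) + the scaling law (2.80) (*"C_□(y, y′) = (L^jη)^{−d−4}C^ξ_□((L^jη)^{−1}y,
(L^jη)^{−1}y′)"*, from (2.71)) ⟹ (2.79) and (2.81) with ONE O(1) and ONE δ₁ for the whole family — the input "δ₁ from
(2.79)" of Prop. 2.3 (`B6.Prop23Printed`; the chain (2.82)–(2.87) is not in this module). [cite: Balaban1984PropagatorsII, (2.78)–(2.81) pp.236–237] -/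
theorem ineq279_281_of_sect5 {I : Type} (h5 : B4.Sect5ThmUniform d N) (fam : I → CubeSite d N)
    {γ₀ c₀ δ₀ K σ : ℝ} (hγ : 0 < γ₀) (hc : 0 < c₀) (hδ : 0 < δ₀) (hK : 0 ≤ K) (hσ : 0 < σ)
    (h278 : ∀ i, B4.Hyp56 (fam i).Ω (fam i).A (γ₀ ^ 2) c₀ δ₀)
    (henc : ∀ i, (fam i).toUseSite.Encodes K σ)
    (ht : ∀ i, 0 < (fam i).t)
    (h280 : ∀ i y y', (fam i).kerCube y y' = (fam i).t ^ (-((d : ℝ) + 4)) * (fam i).ker y y') :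
    ∃ C δ₁ : ℝ, 0 < C ∧ 0 < δ₁ ∧ Ineq279_281 fam C δ₁ :=
  cubeSites_uniform h5 ((d : ℝ) + 4) fam (pow_pos hγ 2) hc hδ hK hσ h278 henc ht h280

/-- (2.148) (with its unit-scale version for C^ξ_□) for the family of all (geometry, j, □), ONE O(1), ONE δ₄ (exponent
d + 2; points = bonds b of 𝔅∩□, ρ(b, b′) = (L^jη)^{−1}|b₋ − b′₋|). [cite: Balaban1984PropagatorsII, (2.148) p.249] -/
def Ineq2148 {I : Type} (fam : I → CubeSite d N) (C δ₄ : ℝ) : Prop :=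
  ScaledFamilyBound ((d : ℝ) + 2) fam C δ₄

/-- KERNEL-CHECKED, site (S4) as an instance of [3] (GAPS G-B6-12: the theorem is not named here, the text says "This
implies"): `B4.Sect5ThmUniform` + for every (geometry, j, □) the instance of (5.6) for the encoded (QG_□Q*)↾_□ on the
unit scale with the lower bound γ₀ of (2.147) (*"⟨B, (QG_□Q*)↾_□B⟩ ≥ γ₀‖B‖² (2.147) with a positive constant γ₀
depending on d and L only"*) and kernel decay (c₀, δ₀) (*"a similar bound from above and an exponential decay of a
kernel of the operator in (2.147)"*, NOT displayed) + encodings with one (K, σ) + the bond scaling law of exponent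
d + 2 (from (2.144) *"⟨B, (QG_□Q*)↾_□B⟩ = (L^jη)^{d+2}⟨B, (QG^ξ_□Q*)↾_□B⟩"*, as (2.80) from (2.71)) ⟹ (2.148) with ONE
O(1) and ONE δ₄ for the whole family — the input of Prop. 2.7 (2.149) (`B6.Prop27Printed`). [cite: Balaban1984PropagatorsII, (2.144)–(2.148) pp.248–249] -/
theorem ineq2148_of_sect5 {I : Type} (h5 : B4.Sect5ThmUniform d N) (fam : I → CubeSite d N)
    {γ₀ c₀ δ₀ K σ : ℝ} (hγ : 0 < γ₀) (hc : 0 < c₀) (hδ : 0 < δ₀) (hK : 0 ≤ K) (hσ : 0 < σ)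
    (h2147 : ∀ i, B4.Hyp56 (fam i).Ω (fam i).A γ₀ c₀ δ₀)
    (henc : ∀ i, (fam i).toUseSite.Encodes K σ)
    (ht : ∀ i, 0 < (fam i).t)
    (h2144 : ∀ i y y', (fam i).kerCube y y' = (fam i).t ^ (-((d : ℝ) + 2)) * (fam i).ker y y') :
    ∃ C δ₄ : ℝ, 0 < C ∧ 0 < δ₄ ∧ Ineq2148 fam C δ₄ :=
  cubeSites_uniform h5 ((d : ℝ) + 2) fam hγ hc hδ hK hσ h2147 henc ht h2144

end UseSites

/-! ## §5  Ledger of this module (for the cell's GAPS / DIVERGENCE rows)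

* G-B6-05a residual (a) — "constants on d and L only, uniformly in j": KERNEL-CHECKED as the quantifier inheritance
  `engine_of_sect5Uniform` / `useSites_uniform` / `cubeSites_uniform` / `reductions_uniform`, conditional on per-site
  instances of (5.6) with i-independent constants (named hypotheses `B4.Hyp56 …`, `UseSite.Encodes`, `Reduction.Printed`).
* G-B6-05a residual (b) — the constrained-subspace reduction at p. 242: KERNEL-CHECKED scheme (`hyp56_sandwich`,
  `decay_2156`, `reductions_uniform`), exactly the one PRINTED at p. 250 for C^{(k)}_Λ; what remains is to exhibit the
  parametrization C of ker Q′₁ with the properties `Reduction.Printed` asks (range, ℓ¹ bounds, ‖CB′‖ ≥ ‖B′‖).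
* G-B6-05a residual (c) — the j-uniform analyticity strip behind the decay of Δ′_j (2.108) and of H′_j (2.132): untouched
  (hypothesis `Reduction.Printed.decay` at (S2), (S3)); = G-B4-02, cf. `…B4Strip`.
* G-B6-12 — (2.147) ⇒ (2.148): `ineq2148_of_sect5` (theorem "not named at this point" now named: `B4.Sect5ThmUniform`).
* Not here: (2.81) ⇒ Prop. 2.3 and (2.148) ⇒ Prop. 2.7 (random walks (2.82)–(2.86)); the B5 decay of Δ_k; the weighted
  symmetrisation (2.69) and the bond encoding (typing remark (i)) — all NAMED in the hypotheses above.
-/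

end Literature.MathematicalPhysics.QuantumFieldTheory.Balaban1983to89.B6FromB4
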